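import Mathlib
import HarnessLib
import Summits.AnomalousDissipation.AnomalousDissipation.Theses.NeutralTaylorWaves

/-!
# Sketch — first lemmas of three crux ideas for `NeutralTaylorWaves.NonresonantSelection`
(stmt-AnomalousDissipation-16294; crux-ideate round 1, ideator k = 2)

* `bordering_lemma`, `pairing_identity`, `pairing_le_of_quasimode` (card `galilean-bordering-cell-pairing`):
  Keller's bordering lemma in a real Hilbert space and the momentum identity for the pairing, PROVED — the bordered a-priori bound follows from (i) a reduced injectivity modulus
  `γ` on `φ^⊥` and (ii) the translation pairing `η ≤ |⟪φ, ψ⟫|`, with constant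
  `1 + ((1+η⁻¹)/γ)² + η⁻²`.
* `lower_bound_of_intertwining` (card `kolmogorov-cell-wave-operator`): an injectivity modulus is
  transported through an intertwining (wave) operator, PROVED; `TransportDiffusionBound`: the
  energy-identity a-priori bound for the REACTION-FREE linearised operator (statement, typed in the
  crux's own vocabulary).
* `exclusion_single`, `selection_of_summable` (card `steady-small-divisor-exclusion`): first-order
  Melnikov exclusion for Lipschitz-monotone branches and the Borel–Cantelli selection of ONE design
  parameter good for all large `n` (PROVED).
-/

set_option linter.dupNamespace false
set_option linter.unusedVariables false

noncomputable section

namespace Summit.AnomalousDissipation.AnomalousDissipation.Cruxes.NonresonantSelection.IdeaSketch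

open MeasureTheory Set Filter Topology Function
open scoped InnerProductSpace
open Literature.Analysis.FunctionSpaces
open Summit.AnomalousDissipation.AnomalousDissipation.Theses.NeutralTaylorWaves

local notation "𝕋³" => UnitAddTorus (Fin 3)
local notation "E³" => EuclideanSpace ℝ (Fin 3)

/-! ### Card 3 — Keller bordering lemma (abstract) -/

/-- **Bordering lemma.** In a real Hilbert space let `L` have `L φ = 0` (`‖φ‖ = 1`), let `ψ`
(`‖ψ‖ = 1`) annihilate the range (`⟪ψ, L v⟫ = 0`), let `L` have injectivity modulus `γ` on `φ^⊥`
and let the translation pairing satisfy `η ≤ |⟪φ, ψ⟫|`. Then the bordered operator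
`(v, b) ↦ (L v − b φ, ⟪v, φ⟫)` obeys `‖v‖² + b² ≤ (1 + ((1+η⁻¹)/γ)² + η⁻²)(‖L v − bφ‖² + ⟪v,φ⟫²)`. -/
theorem bordering_lemma {H : Type*} [NormedAddCommGroup H] [InnerProductSpace ℝ H]
    (L : H →L[ℝ] H) (φ ψ : H) (γ η : ℝ) (hφ : ‖φ‖ = 1) (hψ : ‖ψ‖ = 1) (hγ : 0 < γ) (hη : 0 < η)
    (hker : L φ = 0) (hcoker : ∀ v, ⟪ψ, L v⟫_ℝ = 0)
    (hgap : ∀ v, ⟪v, φ⟫_ℝ = 0 → γ * ‖v‖ ≤ ‖L v‖) (hpair : η ≤ |⟪φ, ψ⟫_ℝ|) :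
    ∀ (v : H) (b : ℝ), ‖v‖ ^ 2 + b ^ 2 ≤
      (1 + ((1 + η⁻¹) / γ) ^ 2 + (η⁻¹) ^ 2) * (‖L v - b • φ‖ ^ 2 + ⟪v, φ⟫_ℝ ^ 2) := by
  intro v b
  set g := L v - b • φ with hg
  set s := ⟪v, φ⟫_ℝ with hs
  -- the drift unknown is controlled by the pairing: |b| η ≤ ‖g‖
  have h1 : ⟪ψ, g⟫_ℝ = -(b * ⟪φ, ψ⟫_ℝ) := by
    rw [hg, inner_sub_right, hcoker v, inner_smul_right, real_inner_comm φ ψ]; ring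
  have hb : |b| * η ≤ ‖g‖ := by
    have h2 : |⟪ψ, g⟫_ℝ| ≤ ‖ψ‖ * ‖g‖ := abs_real_inner_le_norm ψ g
    rw [h1, abs_neg, abs_mul, hψ, one_mul] at h2
    calc |b| * η ≤ |b| * |⟪φ, ψ⟫_ℝ| := mul_le_mul_of_nonneg_left hpair (abs_nonneg b)
      _ ≤ ‖g‖ := h2
  have hb' : |b| ≤ ‖g‖ * η⁻¹ := by
    rw [← div_eq_mul_inv, le_div_iff₀ hη]; exact hb
  -- the part of `v` orthogonal to the phase direction
  set u := v - s • φ with hu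
  have hu0 : ⟪u, φ⟫_ℝ = 0 := by
    rw [hu, inner_sub_left, real_inner_smul_left, real_inner_self_eq_norm_sq, hφ, ← hs]; ring
  have hLu : L u = g + b • φ := by
    rw [hu, map_sub, map_smul, hker, smul_zero, sub_zero, hg]; abel
  have hu1 : γ * ‖u‖ ≤ ‖g‖ + |b| := by
    have h := hgap u hu0
    rw [hLu] at h
    calc γ * ‖u‖ ≤ ‖g + b • φ‖ := h
      _ ≤ ‖g‖ + ‖b • φ‖ := norm_add_le _ _
      _ = ‖g‖ + |b| := by rw [norm_smul, Real.norm_eq_abs, hφ, mul_one]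
  have hu2 : ‖u‖ ≤ ‖g‖ * ((1 + η⁻¹) / γ) := by
    rw [← mul_div_assoc, le_div_iff₀ hγ]
    nlinarith [hu1, hb', norm_nonneg g, inv_pos.2 hη, norm_nonneg u]
  -- Pythagoras
  have hv : ‖v‖ ^ 2 = ‖u‖ ^ 2 + s ^ 2 := by
    have e : v = u + s • φ := by rw [hu]; abel
    have horth : ⟪u, s • φ⟫_ℝ = 0 := by rw [inner_smul_right, hu0, mul_zero]
    rw [e, norm_add_sq_real, horth, norm_smul, Real.norm_eq_abs, hφ, mul_one, sq_abs]; ring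
  have hu3 : ‖u‖ ^ 2 ≤ (‖g‖ * ((1 + η⁻¹) / γ)) ^ 2 := pow_le_pow_left₀ (norm_nonneg u) hu2 2
  have hb3 : b ^ 2 ≤ (‖g‖ * η⁻¹) ^ 2 := by
    calc b ^ 2 = |b| ^ 2 := (sq_abs b).symm
      _ ≤ (‖g‖ * η⁻¹) ^ 2 := pow_le_pow_left₀ (abs_nonneg b) hb' 2
  rw [hv]
  nlinarith [hu3, hb3, sq_nonneg s, sq_nonneg ‖g‖,
    mul_nonneg (sq_nonneg ((1 + η⁻¹) / γ)) (sq_nonneg s), mul_nonneg (sq_nonneg η⁻¹) (sq_nonneg s)]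

/-- **Momentum identity for the translation pairing (abstract).** If `ψ` annihilates the image of
the "mean-zero" subspace `{v | P v = 0}` (`P` idempotent, e.g. the projection onto constants), then
the pairing of `ψ` with `L u` only sees the mean of `u`: `⟪L u, ψ⟫ = ⟪L (P u), ψ⟫`. With `u = g(ψ)e₃`
(an off-band axial shear, `L u = −νΔ(g∘ψ)e₃`) and `P u = ⟨g⟩e₃` (`L e₃ = ∂₃w`) this reads
`⟨g⟩⟪∂₃w, ψ*⟫ = −ν⟪Δ(g∘ψ)e₃, ψ*⟫`: the border pairing is EXACTLY `ν` times an overlap with a fixed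
smooth slow field. -/
theorem pairing_identity {H : Type*} [NormedAddCommGroup H] [InnerProductSpace ℝ H]
    (L P : H →L[ℝ] H) (ψ : H) (hP : ∀ u, P (P u) = P u)
    (hψ : ∀ v, P v = 0 → ⟪L v, ψ⟫_ℝ = 0) : ∀ u, ⟪L u, ψ⟫_ℝ = ⟪L (P u), ψ⟫_ℝ := by
  intro u
  have h0 : P (u - P u) = 0 := by rw [map_sub, hP, sub_self]
  have h1 : ⟪L (u - P u), ψ⟫_ℝ = 0 := hψ _ h0
  rw [map_sub, inner_sub_left, sub_eq_zero] at h1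
  exact h1

/-- **Corollary (quasimode ⇒ the pairing is small; `K₀ ≥ 1`).** If some `u` with `‖P u‖ ≥ p > 0`
has `‖L u‖ ≤ ρ`, then `|⟪L (P u), ψ⟫| ≤ ρ‖ψ‖`: an `O(ν)`-quasimode with `O(1)` mean bounds the
translation pairing by `O(ν)`. -/
theorem pairing_le_of_quasimode {H : Type*} [NormedAddCommGroup H] [InnerProductSpace ℝ H]
    (L P : H →L[ℝ] H) (ψ : H) (hP : ∀ u, P (P u) = P u)
    (hψ : ∀ v, P v = 0 → ⟪L v, ψ⟫_ℝ = 0) (u : H) (ρ : ℝ) (hu : ‖L u‖ ≤ ρ) :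
    |⟪L (P u), ψ⟫_ℝ| ≤ ρ * ‖ψ‖ := by
  rw [← pairing_identity L P ψ hP hψ u]
  exact (abs_real_inner_le_norm _ _).trans (mul_le_mul_of_nonneg_right hu (norm_nonneg _))

/-! ### Card 2 — transport of an injectivity modulus through a wave (intertwining) operator,
and the reaction-free energy bound -/

/-- If `D` intertwines `P` with `A` (`D ∘ P = A ∘ D`), `D` is bounded below by `m` and above by `M`,
and `A` has injectivity modulus `γ`, then `P` has injectivity modulus `γ m / M`. -/
theorem lower_bound_of_intertwining {E : Type*} [NormedAddCommGroup E] [NormedSpace ℝ E]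
    (A P D : E →L[ℝ] E) (γ m M : ℝ) (hγ : 0 < γ) (hm : 0 < m) (hM : 0 < M)
    (hD : ∀ x, m * ‖x‖ ≤ ‖D x‖) (hDM : ∀ x, ‖D x‖ ≤ M * ‖x‖) (hA : ∀ x, γ * ‖x‖ ≤ ‖A x‖)
    (hint : ∀ x, D (P x) = A (D x)) :
    ∀ x, (γ * m / M) * ‖x‖ ≤ ‖P x‖ := by
  intro x
  have h1 : γ * (m * ‖x‖) ≤ ‖A (D x)‖ :=
    (mul_le_mul_of_nonneg_left (hD x) hγ.le).trans (hA (D x))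
  rw [← hint x] at h1
  have h2 : ‖D (P x)‖ ≤ M * ‖P x‖ := hDM (P x)
  rw [div_mul_eq_mul_div, div_le_iff₀ hM]
  nlinarith [h1, h2]

/-- **Reaction-free a-priori bound** (statement; the crux's own vocabulary). For the linearised
steady operator WITHOUT the reaction term `v·∇w` — transport by a smooth divergence-free `w`,
viscosity, pressure, drift — the energy identity `⟨w·∇v − νΔv + ∇r − c∂₃v, v⟩ = ν‖∇v‖²` and the
Poincaré inequality `4π²∫|v|² ≤ ‖∇v‖²` (`Torus.integral_norm_sq_le_gradNormSq_of_hasZeroMean`)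
give the POLYNOMIAL bound `∫|v|² ≤ (4π²ν)⁻² ∫|w·∇v − νΔv + ∇r − c∂₃v|²`, whatever the
non-normality of the transport. The wave operator conjugates the reaction term away in sector S1. -/
def TransportDiffusionBound : Prop :=
  ∀ (ν c : ℝ) (w v : 𝕋³ → E³) (r : 𝕋³ → ℝ), 0 < ν →
    Torus.IsSmooth w → Torus.IsDivFree w → Torus.IsSmooth v → Torus.IsDivFree v →
    Torus.HasZeroMean v → Torus.IsSmooth r →
    MeasureTheory.integral MeasureTheory.volume (fun x => ‖v x‖ ^ 2) ≤
      ((4 * Real.pi ^ 2 * ν)⁻¹) ^ 2 * MeasureTheory.integral MeasureTheory.volume (fun x =>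
        ‖Torus.convect w v x - ν • Torus.laplacian v x + Torus.gradient r x -
          c • Torus.partialDeriv (2 : Fin 3) v x‖ ^ 2)

/-! ### Card 1 — first-order Melnikov exclusion and Borel–Cantelli selection of ONE parameter -/

/-- **Exclusion for one `n`.** `N` real branches `μ i`, each moving with speed at least `c` in the
parameter (`c|l₁ − l₂| ≤ |μ i l₁ − μ i l₂|`): the parameters at which SOME branch is `δ`-close to
`0` have measure `≤ N · 2δ/c`. -/
theorem exclusion_single (N : ℕ) (μ : Fin N → ℝ → ℝ) (c δ : ℝ) (hc : 0 < c) (hδ : 0 < δ)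
    (hmono : ∀ i l₁ l₂, c * |l₁ - l₂| ≤ |μ i l₁ - μ i l₂|) :
    MeasureTheory.volume {l : ℝ | ∃ i, |μ i l| < δ} ≤ ENNReal.ofReal (N * (2 * δ / c)) := by
  have hset : {l : ℝ | ∃ i, |μ i l| < δ} = ⋃ i, {l : ℝ | |μ i l| < δ} := by
    ext l; simp
  have hdiam : ∀ i, MeasureTheory.volume {l : ℝ | |μ i l| < δ} ≤ ENNReal.ofReal (2 * δ / c) := by
    intro i
    refine (Real.volume_le_diam _).trans (Metric.ediam_le ?_)
    intro x hx y hy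
    simp only [Set.mem_setOf_eq] at hx hy
    rw [edist_dist, Real.dist_eq]
    apply ENNReal.ofReal_le_ofReal
    rw [le_div_iff₀ hc]
    have h := hmono i x y
    have h' : |μ i x - μ i y| < 2 * δ := by
      calc |μ i x - μ i y| ≤ |μ i x| + |μ i y| := abs_sub _ _
        _ < δ + δ := add_lt_add hx hy
        _ = 2 * δ := by ring
    nlinarith [h, h', abs_nonneg (x - y)]
  rw [hset]
  refine (measure_iUnion_le _).trans ?_
  calc ∑' i, MeasureTheory.volume {l : ℝ | |μ i l| < δ}
      ≤ ∑' i : Fin N, ENNReal.ofReal (2 * δ / c) := ENNReal.tsum_le_tsum hdiam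
    _ = N * ENNReal.ofReal (2 * δ / c) := by
        rw [tsum_fintype, Finset.sum_const, Finset.card_univ, Fintype.card_fin, nsmul_eq_mul]
    _ = ENNReal.ofReal (N * (2 * δ / c)) := by
        rw [ENNReal.ofReal_mul (Nat.cast_nonneg N), ENNReal.ofReal_natCast]

/-- **Selection of ONE parameter good for all large `n`** (Borel–Cantelli): if the bad parameter
sets `bad n` have summable measure, some parameter in any non-null set `S` is eventually good —
hence good along infinitely many `n`, which is the quantifier shape `∀ N ∃ n ≥ N` of the crux. -/
theorem selection_of_summable (bad : ℕ → Set ℝ) (S : Set ℝ)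
    (hsum : ∑' n, MeasureTheory.volume (bad n) ≠ ⊤) (hS : MeasureTheory.volume S ≠ 0) :
    ∃ l ∈ S, ∃ N : ℕ, ∀ n ≥ N, l ∉ bad n := by
  have h0 : MeasureTheory.volume (Filter.limsup bad Filter.atTop) = 0 :=
    MeasureTheory.measure_limsup_atTop_eq_zero hsum
  have hpos : MeasureTheory.volume (S \ Filter.limsup bad Filter.atTop) ≠ 0 := by
    intro h
    apply hS
    have hsub : S ⊆ (S \ Filter.limsup bad Filter.atTop) ∪ Filter.limsup bad Filter.atTop := by
      intro x hx
      by_cases hx' : x ∈ Filter.limsup bad Filter.atTop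
      · exact Or.inr hx'
      · exact Or.inl ⟨hx, hx'⟩
    exact measure_mono_null hsub (measure_union_null h h0)
  obtain ⟨l, hlS, hl⟩ := MeasureTheory.nonempty_of_measure_ne_zero hpos
  refine ⟨l, hlS, ?_⟩
  rw [Filter.limsup_eq_iInf_iSup_of_nat] at hl
  simp only [Set.iInf_eq_iInter, Set.iSup_eq_iUnion, Set.mem_iInter, Set.mem_iUnion, not_forall,
    not_exists] at hl
  obtain ⟨N, hN⟩ := hl
  exact ⟨N, fun n hn => hN n hn⟩

/-- The crux-shaped consequence: an eventually-good parameter is good infinitely often. -/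
theorem frequently_good_of_eventually {l : ℝ} {bad : ℕ → Set ℝ} (h : ∃ N : ℕ, ∀ n ≥ N, l ∉ bad n) :
    ∀ N : ℕ, ∃ n : ℕ, N ≤ n ∧ l ∉ bad n := by
  obtain ⟨N₀, hN₀⟩ := h
  intro N
  exact ⟨max N N₀, le_max_left _ _, hN₀ _ (le_max_right _ _)⟩

end Summit.AnomalousDissipation.AnomalousDissipation.Cruxes.NonresonantSelection.IdeaSketch

end
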